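import Literature.Barriers.FinalStateConjecture.NonSmoothNullInfinityRadius
import Literature.Analysis.Calculus.HadamardLemma
import Mathlib.Analysis.Calculus.ParametricIntegral
import Mathlib.Analysis.Calculus.ParametricIntervalIntegral
import Mathlib.MeasureTheory.Integral.DominatedConvergence
import HarnessLib

/-!
# Barrier catalogue `FinalStateConjecture`: null-line primitives for the linear scattering problem
# on Schwarzschild (support file for the discharge of `KehrbergerLogarithmicAsymptoticsCorrected`)
(`Literature/Barriers/FinalStateConjecture/`; namespace `Literature.Barriers.FinalStateConjecture`)

The scattering solution of `∂ᵤ∂ᵥψ = −V(r) ψ` (`V = radialPotential M`, `r` an EF area radius) with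
data `G` on `𝓘⁻` is the fixed point of `ψ = G − ∫_{v₁}^{v} ∫_{−∞}^{u} V ψ du' dv'` (Kehrberger,
arXiv:2105.08079, §6; the sequel file constructs it). This file provides the two integral
operators the construction, the regularity bootstrap and all later estimates are phrased in, with
their continuity and differentiation rules:

* `vPrimitive v₁ g (u, v) = ∫_{v₁}^{v} g(u, v') dv'` — continuity (`continuous_vPrimitive`),
  `∂ᵥ = g` (`hasDerivAt_vPrimitive_right`, FTC) and `∂ᵤ ∫ = ∫ ∂ᵤ`
  (`hasDerivAt_vPrimitive_left`, Leibniz rule on a compact interval);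
* `uPrimitive h (u, v) = ∫_{−∞}^{u} h(u', v) du'` for integrands dominated on past strips
  `{v ≤ V}` by a multiple of the potential `V(r(u', v))` (`IsPotentialDominated`; the potential is
  integrable along ingoing null lines with `∫_{−∞}^{u} V = M/r²`, `NonSmoothNullInfinityRadius`):
  integrability, the bound `|uPrimitive h| ≤ B M/r² ≤ B/(4M)`, decay `→ 0` as `u → −∞`,
  continuity (`continuous_uPrimitive`), `∂ᵤ = h` (`hasDerivAt_uPrimitive_left`) and `∂ᵥ ∫ = ∫ ∂ᵥ`
  (`hasDerivAt_uPrimitive_right`, dominated differentiation);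
* the elementary calculus of the coefficient functions `1/r(u,v)` and `V(r(u,v))` along both null
  directions (`∂ᵤ(1/r) = (1 − 2M/r)/r²`, `∂ᵥ(1/r) = −(1 − 2M/r)/r²`).

Standard real analysis (Leibniz rule, dominated convergence; Dieudonné (1960), (8.11.2)); nothing
here is specific to Kehrberger's paper beyond the choice of weights. [folklore]
-/

noncomputable section

open Set Filter Topology MeasureTheory intervalIntegral Function

namespace Literature.Barriers.FinalStateConjecture

/-! ### The primitive along outgoing null lines: `∫_{v₁}^{v} g(u, v') dv'` -/

/-- **The `v`-primitive** `vPrimitive v₁ g (u, v) = ∫_{v₁}^{v} g(u, v') dv'` (oriented interval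
integral; for `v < v₁` it is `−∫_v^{v₁}`). [folklore] -/
def vPrimitive (v₁ : ℝ) (g : ℝ → ℝ → ℝ) (u v : ℝ) : ℝ := ∫ v' in v₁..v, g u v'

section VPrimitive

variable {v₁ : ℝ} {g g₁ : ℝ → ℝ → ℝ}

/-- Unfolding lemma. [folklore] -/
lemma vPrimitive_apply (v₁ : ℝ) (g : ℝ → ℝ → ℝ) (u v : ℝ) :
    vPrimitive v₁ g u v = ∫ v' in v₁..v, g u v' := rfl

/-- `vPrimitive v₁ g (u, v₁) = 0`. [folklore] -/
@[simp] lemma vPrimitive_self (v₁ : ℝ) (g : ℝ → ℝ → ℝ) (u : ℝ) : vPrimitive v₁ g u v₁ = 0 := by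
  simp [vPrimitive]

/-- A slice `v' ↦ g(u, v')` of a jointly continuous function is continuous. [folklore] -/
lemma continuous_slice_right {g : ℝ → ℝ → ℝ} (hg : Continuous (uncurry g)) (u : ℝ) :
    Continuous (fun v ↦ g u v) :=
  hg.comp (Continuous.prodMk_right u)

/-- A slice `u' ↦ g(u', v)` of a jointly continuous function is continuous. [folklore] -/
lemma continuous_slice_left {g : ℝ → ℝ → ℝ} (hg : Continuous (uncurry g)) (v : ℝ) :
    Continuous (fun u ↦ g u v) :=
  hg.comp (Continuous.prodMk_left v)

/-- The `v`-primitive of a jointly continuous function is jointly continuous. [folklore] -/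
theorem continuous_vPrimitive (hg : Continuous (uncurry g)) :
    Continuous (uncurry (vPrimitive v₁ g)) :=
  intervalIntegral.continuous_parametric_primitive_of_continuous hg

/-- **FTC along outgoing null lines**: `∂ᵥ ∫_{v₁}^{v} g(u,v') dv' = g(u,v)`. [folklore] -/
theorem hasDerivAt_vPrimitive_right (hg : Continuous (uncurry g)) (u v : ℝ) :
    HasDerivAt (fun v' ↦ vPrimitive v₁ g u v') (g u v) v := by
  have hc : Continuous (fun v ↦ g u v) := continuous_slice_right hg u
  exact intervalIntegral.integral_hasDerivAt_right (hc.intervalIntegrable _ _)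
    (hc.stronglyMeasurableAtFilter _ _) hc.continuousAt

/-- **Leibniz rule along outgoing null lines**: if `∂ᵤ g = g₁` with `g`, `g₁` jointly continuous,
then `∂ᵤ ∫_{v₁}^{v} g(u,v') dv' = ∫_{v₁}^{v} g₁(u,v') dv'`. [folklore] -/
theorem hasDerivAt_vPrimitive_left (hg : Continuous (uncurry g)) (hg₁ : Continuous (uncurry g₁))
    (hd : ∀ u v, HasDerivAt (fun u' ↦ g u' v) (g₁ u v) u) (u v : ℝ) :
    HasDerivAt (fun u' ↦ vPrimitive v₁ g u' v) (vPrimitive v₁ g₁ u v) u := by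
  obtain ⟨C, s, hs, hC⟩ :=
    Literature.Analysis.Calculus.exists_mem_nhds_forall_norm_le_of_continuous hg₁ u v₁ v
  have h := intervalIntegral.hasDerivAt_integral_of_dominated_loc_of_deriv_le
    (μ := volume) (F := fun u' t ↦ g u' t) (F' := fun u' t ↦ g₁ u' t) (bound := fun _ ↦ C) hs
    (Eventually.of_forall fun u' ↦ (continuous_slice_right hg u').aestronglyMeasurable)
    ((continuous_slice_right hg u).intervalIntegrable _ _)
    (continuous_slice_right hg₁ u).aestronglyMeasurable
    (Eventually.of_forall fun t ht u' hu' ↦ hC u' hu' t (uIoc_subset_uIcc ht))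
    intervalIntegrable_const
    (Eventually.of_forall fun t _ u' _ ↦ hd u' t)
  exact h.2

/-- If `g(u, ·)` vanishes on `(−∞, v₁]` then so does its `v`-primitive from `v₁`. [folklore] -/
lemma vPrimitive_eq_zero_of_le (h0 : ∀ u v, v ≤ v₁ → g u v = 0) {u v : ℝ} (hv : v ≤ v₁) :
    vPrimitive v₁ g u v = 0 := by
  rw [vPrimitive_apply]
  have : ∫ v' in v₁..v, g u v' = ∫ v' in v₁..v, (0 : ℝ) := by
    refine intervalIntegral.integral_congr fun x hx ↦ ?_
    rw [uIcc_of_ge hv] at hx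
    exact h0 u x hx.2
  rw [this, intervalIntegral.integral_zero]

/-- Bound for the `v`-primitive on `v ≥ v₁`: `|∫_{v₁}^{v} g| ≤ (v − v₁) B` if `|g(u,·)| ≤ B` on
`[v₁, v]`. [folklore] -/
lemma abs_vPrimitive_le {u v B : ℝ} (hv : v₁ ≤ v)
    (hB : ∀ v' ∈ Icc v₁ v, |g u v'| ≤ B) : |vPrimitive v₁ g u v| ≤ (v - v₁) * B := by
  rw [vPrimitive_apply]
  have h := intervalIntegral.norm_integral_le_of_norm_le_const (a := v₁) (b := v) (C := B)
    (f := fun v' ↦ g u v') fun x hx ↦ ?_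
  · rw [Real.norm_eq_abs, abs_of_nonneg (sub_nonneg.2 hv)] at h
    simpa [mul_comm] using h
  · rw [uIoc_of_le hv] at hx
    simpa using hB x ⟨hx.1.le, hx.2⟩

/-- The `v`-primitive is additive (continuous integrands). [folklore] -/
lemma vPrimitive_add (hg : Continuous (uncurry g)) (hg₁ : Continuous (uncurry g₁)) :
    vPrimitive v₁ (fun u v ↦ g u v + g₁ u v) = fun u v ↦ vPrimitive v₁ g u v + vPrimitive v₁ g₁ u v := by
  funext u v
  simp only [vPrimitive_apply]
  exact intervalIntegral.integral_add ((continuous_slice_right hg u).intervalIntegrable _ _)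
    ((continuous_slice_right hg₁ u).intervalIntegrable _ _)

/-- The `v`-primitive is subtractive (continuous integrands). [folklore] -/
lemma vPrimitive_sub (hg : Continuous (uncurry g)) (hg₁ : Continuous (uncurry g₁)) :
    vPrimitive v₁ (fun u v ↦ g u v - g₁ u v) = fun u v ↦ vPrimitive v₁ g u v - vPrimitive v₁ g₁ u v := by
  funext u v
  simp only [vPrimitive_apply]
  exact intervalIntegral.integral_sub ((continuous_slice_right hg u).intervalIntegrable _ _)
    ((continuous_slice_right hg₁ u).intervalIntegrable _ _)

/-- Constants come out of the `v`-primitive. [folklore] -/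
lemma vPrimitive_const_mul (c : ℝ) (g : ℝ → ℝ → ℝ) :
    vPrimitive v₁ (fun u v ↦ c * g u v) = fun u v ↦ c * vPrimitive v₁ g u v := by
  funext u v
  simp only [vPrimitive_apply]
  exact intervalIntegral.integral_const_mul c _

end VPrimitive

/-! ### The primitive along ingoing null lines from `𝓘⁻`: `∫_{−∞}^{u} h(u', v) du'` -/

/-- **The `u`-primitive from `𝓘⁻`**: `uPrimitive h (u, v) = ∫_{−∞}^{u} h(u', v) du'` (Bochner
integral over `Iic u`; it is the honest improper integral for the potential-dominated integrands
used below). [folklore] -/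
def uPrimitive (h : ℝ → ℝ → ℝ) (u v : ℝ) : ℝ := ∫ u' in Iic u, h u' v

/-- **Potential domination on past strips**: on every strip `{v ≤ V}` (all `u`), `|h(u, v)|` is
bounded by a multiple of the potential `V(r(u,v)) = 2M(1 − 2M/r)/r³` — the integrability class of
the `u`-primitive (the potential is integrable along ingoing null lines, `∫_{−∞}^{u} V = M/r²`).
[folklore] -/
def IsPotentialDominated (M : ℝ) (r : ℝ → ℝ → ℝ) (h : ℝ → ℝ → ℝ) : Prop :=
  ∀ V : ℝ, ∃ B : ℝ, ∀ u v, v ≤ V → |h u v| ≤ B * radialPotential M (r u v)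

section UPrimitive

variable {M : ℝ} {r : ℝ → ℝ → ℝ} {h h₂ : ℝ → ℝ → ℝ}

/-- Unfolding lemma. [folklore] -/
lemma uPrimitive_apply (h : ℝ → ℝ → ℝ) (u v : ℝ) :
    uPrimitive h u v = ∫ u' in Iic u, h u' v := rfl

variable (hr : IsEFAreaRadius M r) (hM : 0 < M)
include hr hM

/-- The constant of a potential domination may be taken nonnegative (the potential is positive
on the exterior). [folklore] -/
lemma IsPotentialDominated.exists_nonneg (hh : IsPotentialDominated M r h) (V : ℝ) :
    ∃ B : ℝ, 0 ≤ B ∧ ∀ u v, v ≤ V → |h u v| ≤ B * radialPotential M (r u v) := by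
  obtain ⟨B, hB⟩ := hh V
  refine ⟨max B 0, le_max_right _ _, fun u v hv ↦ (hB u v hv).trans ?_⟩
  exact mul_le_mul_of_nonneg_right (le_max_left _ _) (radialPotential_pos hM (hr.1 u v)).le

/-- `2M/r(u',v)³ ≤ V(r(u',v))/(1 − 2M/r(U,v))` for `u' ≤ U` (since `r(u',v) ≥ r(U,v)`): the cube of
the inverse radius is dominated by the potential on every past half-line. [folklore] -/
lemma two_mul_div_cube_le_potential {U u' : ℝ} (hu' : u' ≤ U) (v : ℝ) :
    2 * M / r u' v ^ 3 ≤ radialPotential M (r u' v) / (1 - 2 * M / r U v) := by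
  have hrU : 2 * M < r U v := hr.1 U v
  have hrU0 : 0 < r U v := hr.pos hM.le U v
  have hru : r U v ≤ r u' v := (hr.strictAnti_left hM v).antitone hu'
  have hr0 : 0 < r u' v := hr.pos hM.le u' v
  have hD0 : 0 < 1 - 2 * M / r U v := by
    rw [sub_pos, div_lt_one hrU0]; exact hrU
  have hDle : 1 - 2 * M / r U v ≤ 1 - 2 * M / r u' v := by
    have : 2 * M / r u' v ≤ 2 * M / r U v :=
      div_le_div_of_nonneg_left (by positivity) hrU0 hru
    linarith
  rw [le_div_iff₀ hD0, radialPotential]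
  have h3 : 0 < r u' v ^ 3 := by positivity
  rw [div_mul_eq_mul_div, div_le_div_iff_of_pos_right h3]
  calc 2 * M * (1 - 2 * M / r U v) ≤ 2 * M * (1 - 2 * M / r u' v) :=
        mul_le_mul_of_nonneg_left hDle (by positivity)
    _ = 2 * M * (1 - 2 * M / r u' v) := rfl

/-- `u' ↦ 2M/r(u',v)³` is integrable on every past half-line `(−∞, U]`. [folklore] -/
lemma integrableOn_two_mul_div_cube (U v : ℝ) :
    IntegrableOn (fun u' ↦ 2 * M / r u' v ^ 3) (Iic U) := by
  have hcont : Continuous (fun u' ↦ 2 * M / r u' v ^ 3) := by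
    have hc : Continuous (fun u' ↦ r u' v) :=
      continuous_slice_left (hr.contDiff_uncurry hM).continuous v
    exact continuous_const.div (hc.pow 3) fun u' ↦ pow_ne_zero 3 (hr.pos hM.le u' v).ne'
  refine Integrable.mono' ((hr.integrableOn_potential_Iic hM U v).div_const (1 - 2 * M / r U v))
    hcont.aestronglyMeasurable ?_
  refine (ae_restrict_iff' measurableSet_Iic).2 (Eventually.of_forall fun u' hu' ↦ ?_)
  rw [Real.norm_eq_abs, abs_of_pos (by have := hr.pos hM.le u' v; positivity)]
  exact two_mul_div_cube_le_potential hr hM hu' v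

/-- The potential is at most `2M/r³` and `r` increases in `v`: for `v₀ ≤ v`,
`V(r(u,v)) ≤ 2M/r(u,v₀)³` — a `v`-uniform majorant along ingoing null lines. [folklore] -/
lemma potential_le_two_mul_div_cube {v₀ v : ℝ} (hv : v₀ ≤ v) (u : ℝ) :
    radialPotential M (r u v) ≤ 2 * M / r u v₀ ^ 3 := by
  have h1 : radialPotential M (r u v) ≤ 2 * M / r u v ^ 3 := radialPotential_le hM.le (hr.pos hM.le u v)
  have h2 : r u v₀ ≤ r u v := (hr.strictMono_right hM u).monotone hv
  have h3 : 0 < r u v₀ := hr.pos hM.le u v₀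
  calc radialPotential M (r u v) ≤ 2 * M / r u v ^ 3 := h1
    _ ≤ 2 * M / r u v₀ ^ 3 := by gcongr

/-- A continuous, potential-dominated integrand is integrable along every ingoing null line
towards `𝓘⁻`. [folklore] -/
theorem IsPotentialDominated.integrableOn (hh : IsPotentialDominated M r h)
    (hc : Continuous (uncurry h)) (u v : ℝ) : IntegrableOn (fun u' ↦ h u' v) (Iic u) := by
  obtain ⟨B, hB0, hB⟩ := hh.exists_nonneg hr hM v
  refine Integrable.mono' (((hr.integrableOn_potential_Iic hM u v)).const_mul B)
    (continuous_slice_left hc v).aestronglyMeasurable (Eventually.of_forall fun u' ↦ ?_)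
  rw [Real.norm_eq_abs]
  exact hB u' v le_rfl

/-- **The basic bound**: if `|h(u', v)| ≤ B V(r(u',v))` for all `u'`, then
`|∫_{−∞}^{u} h(u',v) du'| ≤ B M/r(u,v)²`. [folklore] -/
theorem abs_uPrimitive_le {B : ℝ} {u v : ℝ}
    (hB : ∀ u', |h u' v| ≤ B * radialPotential M (r u' v)) :
    |uPrimitive h u v| ≤ B * (M / r u v ^ 2) := by
  rw [uPrimitive_apply, ← Real.norm_eq_abs, ← hr.integral_potential_Iic hM u v,
    ← MeasureTheory.integral_const_mul]
  refine norm_integral_le_of_norm_le ((hr.integrableOn_potential_Iic hM u v).const_mul B) ?_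
  exact (ae_restrict_iff' measurableSet_Iic).2 (Eventually.of_forall fun u' _ ↦ hB u')

/-- `M/r² < 1/(4M)` on the exterior (`r > 2M > 0`). [folklore] -/
lemma div_sq_lt (u v : ℝ) : M / r u v ^ 2 < 1 / (4 * M) := by
  have h2 : 2 * M < r u v := hr.1 u v
  have h0 : 0 < r u v := hr.pos hM.le u v
  rw [div_lt_div_iff₀ (by positivity) (by positivity)]
  nlinarith [mul_pos hM hM, mul_lt_mul'' h2 h2 (by positivity) (by positivity)]

/-- A potential-dominated `u`-primitive is bounded on past strips: `|uPrimitive h| ≤ B/(4M)` on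
`{v ≤ V}` (all `u`). [folklore] -/
theorem IsPotentialDominated.uPrimitive_bounded (hh : IsPotentialDominated M r h) (V : ℝ) :
    ∃ C : ℝ, ∀ u v, v ≤ V → |uPrimitive h u v| ≤ C := by
  obtain ⟨B, hB0, hB⟩ := hh.exists_nonneg hr hM V
  refine ⟨B * (1 / (4 * M)), fun u v hv ↦ ?_⟩
  refine (abs_uPrimitive_le hr hM fun u' ↦ hB u' v hv).trans ?_
  exact mul_le_mul_of_nonneg_left (div_sq_lt hr hM u v).le hB0

/-- A potential-dominated `u`-primitive tends to `0` towards `𝓘⁻` (`u → −∞`), for each `v`.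
[folklore] -/
theorem IsPotentialDominated.tendsto_uPrimitive_atBot (hh : IsPotentialDominated M r h) (v : ℝ) :
    Tendsto (fun u ↦ uPrimitive h u v) atBot (𝓝 0) := by
  obtain ⟨B, hB0, hB⟩ := hh.exists_nonneg hr hM v
  have hlim : Tendsto (fun u ↦ B * (M / r u v ^ 2)) atBot (𝓝 0) := by
    simpa using (hr.tendsto_div_sq_atBot hM v).const_mul B
  refine squeeze_zero_norm (fun u ↦ ?_) hlim
  rw [Real.norm_eq_abs]
  exact abs_uPrimitive_le hr hM fun u' ↦ hB u' v le_rfl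

/-- Splitting the `u`-primitive at a base point: `∫_{−∞}^{u} = ∫_{−∞}^{a} + ∫_a^u`. [folklore] -/
lemma uPrimitive_eq_add_intervalIntegral (hh : IsPotentialDominated M r h)
    (hc : Continuous (uncurry h)) (a u v : ℝ) :
    uPrimitive h u v = uPrimitive h a v + ∫ u' in a..u, h u' v := by
  rw [uPrimitive_apply, uPrimitive_apply,
    ← intervalIntegral.integral_Iic_sub_Iic (hh.integrableOn hr hM hc a v)
      (hh.integrableOn hr hM hc u v)]
  ring

/-- **FTC along ingoing null lines**: `∂ᵤ ∫_{−∞}^{u} h(u',v) du' = h(u,v)`. [folklore] -/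
theorem hasDerivAt_uPrimitive_left (hh : IsPotentialDominated M r h) (hc : Continuous (uncurry h))
    (u v : ℝ) : HasDerivAt (fun u' ↦ uPrimitive h u' v) (h u v) u := by
  have hcv : Continuous (fun u' ↦ h u' v) := continuous_slice_left hc v
  have heq : (fun u' ↦ uPrimitive h u' v) =
      fun u' ↦ uPrimitive h (u - 1) v + ∫ x in (u - 1)..u', h x v :=
    funext fun u' ↦ uPrimitive_eq_add_intervalIntegral hr hM hh hc (u - 1) u' v
  rw [heq]
  refine (HasDerivAt.const_add _ ?_)
  exact intervalIntegral.integral_hasDerivAt_right (hcv.intervalIntegrable _ _)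
    (hcv.stronglyMeasurableAtFilter _ _) hcv.continuousAt

/-- Continuity in `v` of `∫_{−∞}^{a} h(u', v) du'` (dominated convergence with the majorant
`2M B/r(u', v₀ − 1)³` on `v ∈ (v₀ − 1, v₀ + 1)`). [folklore] -/
lemma continuousAt_uPrimitive_right (hh : IsPotentialDominated M r h)
    (hc : Continuous (uncurry h)) (a v₀ : ℝ) :
    ContinuousAt (fun v ↦ uPrimitive h a v) v₀ := by
  obtain ⟨B, hB0, hB⟩ := hh.exists_nonneg hr hM (v₀ + 1)
  simp only [uPrimitive_apply]
  refine MeasureTheory.continuousAt_of_dominated (bound := fun u' ↦ B * (2 * M / r u' (v₀ - 1) ^ 3))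
    (Eventually.of_forall fun v ↦ (continuous_slice_left hc v).aestronglyMeasurable) ?_
    ((integrableOn_two_mul_div_cube hr hM a (v₀ - 1)).const_mul B)
    (Eventually.of_forall fun u' ↦ (continuous_slice_right hc u').continuousAt)
  have hs : Ioo (v₀ - 1) (v₀ + 1) ∈ 𝓝 v₀ := Ioo_mem_nhds (by linarith) (by linarith)
  filter_upwards [hs] with v hv
  refine Eventually.of_forall fun u' ↦ ?_
  rw [Real.norm_eq_abs]
  refine (hB u' v hv.2.le).trans ?_
  exact mul_le_mul_of_nonneg_left (potential_le_two_mul_div_cube hr hM hv.1.le u') hB0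

/-- **Joint continuity of the `u`-primitive** of a continuous potential-dominated integrand.
[folklore] -/
theorem continuous_uPrimitive (hh : IsPotentialDominated M r h) (hc : Continuous (uncurry h)) :
    Continuous (uncurry (uPrimitive h)) := by
  rw [continuous_iff_continuousAt]
  rintro ⟨u₀, v₀⟩
  -- split at the base point `a = u₀ - 1`
  have heq : uncurry (uPrimitive h) =
      fun p : ℝ × ℝ ↦ uPrimitive h (u₀ - 1) p.2 + ∫ x in (u₀ - 1)..p.1, h x p.2 := by
    funext p
    exact uPrimitive_eq_add_intervalIntegral hr hM hh hc (u₀ - 1) p.1 p.2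
  rw [heq]
  refine ContinuousAt.add ?_ ?_
  · exact ContinuousAt.comp (g := fun v ↦ uPrimitive h (u₀ - 1) v)
      (continuousAt_uPrimitive_right hr hM hh hc (u₀ - 1) v₀) continuousAt_snd
  · have hsw : Continuous (uncurry fun (v u' : ℝ) ↦ h u' v) :=
      hc.comp (continuous_snd.prodMk continuous_fst)
    have h2 := intervalIntegral.continuous_parametric_primitive_of_continuous
      (μ := volume) (a₀ := u₀ - 1) hsw
    exact (h2.comp (continuous_snd.prodMk continuous_fst)).continuousAt

/-- **Dominated differentiation along ingoing null lines**: if `∂ᵥ h = h₂` with `h`, `h₂`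
continuous and potential-dominated, then `∂ᵥ ∫_{−∞}^{u} h(u',v) du' = ∫_{−∞}^{u} h₂(u',v) du'`.
[folklore] -/
theorem hasDerivAt_uPrimitive_right (hh : IsPotentialDominated M r h) (hc : Continuous (uncurry h))
    (hh₂ : IsPotentialDominated M r h₂) (hc₂ : Continuous (uncurry h₂))
    (hd : ∀ u v, HasDerivAt (fun v' ↦ h u v') (h₂ u v) v) (u v : ℝ) :
    HasDerivAt (fun v' ↦ uPrimitive h u v') (uPrimitive h₂ u v) v := by
  obtain ⟨B, hB0, hB⟩ := hh₂.exists_nonneg hr hM (v + 1)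
  have hs : Ioo (v - 1) (v + 1) ∈ 𝓝 v := Ioo_mem_nhds (by linarith) (by linarith)
  simp only [uPrimitive_apply]
  have key := hasDerivAt_integral_of_dominated_loc_of_deriv_le (μ := volume.restrict (Iic u))
    (F := fun v' u' ↦ h u' v') (F' := fun v' u' ↦ h₂ u' v') (x₀ := v)
    (bound := fun u' ↦ B * (2 * M / r u' (v - 1) ^ 3)) hs
    (Eventually.of_forall fun v' ↦ (continuous_slice_left hc v').aestronglyMeasurable)
    (hh.integrableOn hr hM hc u v) (continuous_slice_left hc₂ v).aestronglyMeasurable ?_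
    ((integrableOn_two_mul_div_cube hr hM u (v - 1)).const_mul B)
    (Eventually.of_forall fun u' v' _ ↦ hd u' v')
  · exact key.2
  · refine Eventually.of_forall fun u' v' hv' ↦ ?_
    rw [Real.norm_eq_abs]
    refine (hB u' v' hv'.2.le).trans ?_
    exact mul_le_mul_of_nonneg_left (potential_le_two_mul_div_cube hr hM hv'.1.le u') hB0

/-- The `u`-primitive is additive (continuous potential-dominated integrands). [folklore] -/
lemma uPrimitive_add (hh : IsPotentialDominated M r h) (hc : Continuous (uncurry h))
    (hh₂ : IsPotentialDominated M r h₂) (hc₂ : Continuous (uncurry h₂)) :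
    uPrimitive (fun u v ↦ h u v + h₂ u v) = fun u v ↦ uPrimitive h u v + uPrimitive h₂ u v := by
  funext u v
  simp only [uPrimitive_apply]
  exact integral_add (hh.integrableOn hr hM hc u v) (hh₂.integrableOn hr hM hc₂ u v)

/-- The `u`-primitive is subtractive (continuous potential-dominated integrands). [folklore] -/
lemma uPrimitive_sub (hh : IsPotentialDominated M r h) (hc : Continuous (uncurry h))
    (hh₂ : IsPotentialDominated M r h₂) (hc₂ : Continuous (uncurry h₂)) :
    uPrimitive (fun u v ↦ h u v - h₂ u v) = fun u v ↦ uPrimitive h u v - uPrimitive h₂ u v := by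
  funext u v
  simp only [uPrimitive_apply]
  exact integral_sub (hh.integrableOn hr hM hc u v) (hh₂.integrableOn hr hM hc₂ u v)

omit hr hM in
/-- Constants come out of the `u`-primitive. [folklore] -/
lemma uPrimitive_const_mul (c : ℝ) (h : ℝ → ℝ → ℝ) :
    uPrimitive (fun u v ↦ c * h u v) = fun u v ↦ c * uPrimitive h u v := by
  funext u v
  simp only [uPrimitive_apply]
  exact MeasureTheory.integral_const_mul c _

omit hr hM in
/-- If the integrand vanishes on `{v ≤ v₁}` then so does its `u`-primitive. [folklore] -/
lemma uPrimitive_eq_zero_of_le {v₁ : ℝ} (h0 : ∀ u v, v ≤ v₁ → h u v = 0) {u v : ℝ} (hv : v ≤ v₁) :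
    uPrimitive h u v = 0 := by
  simp only [uPrimitive_apply, h0 _ v hv, integral_zero]

omit hr hM in
/-- Potential domination is preserved by sums. [folklore] -/
lemma IsPotentialDominated.add (hh : IsPotentialDominated M r h) (hh₂ : IsPotentialDominated M r h₂) :
    IsPotentialDominated M r (fun u v ↦ h u v + h₂ u v) := by
  intro V
  obtain ⟨B, hB⟩ := hh V
  obtain ⟨B₂, hB₂⟩ := hh₂ V
  refine ⟨B + B₂, fun u v hv ↦ ?_⟩
  calc |h u v + h₂ u v| ≤ |h u v| + |h₂ u v| := abs_add_le _ _
    _ ≤ B * radialPotential M (r u v) + B₂ * radialPotential M (r u v) := add_le_add (hB u v hv) (hB₂ u v hv)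
    _ = (B + B₂) * radialPotential M (r u v) := by ring

/-- Potential domination is preserved by bounded multipliers on past strips. [folklore] -/
lemma IsPotentialDominated.mul_left (hh : IsPotentialDominated M r h) {c : ℝ → ℝ → ℝ}
    (hcb : ∀ V, ∃ C, ∀ u v, v ≤ V → |c u v| ≤ C) :
    IsPotentialDominated M r (fun u v ↦ c u v * h u v) := by
  intro V
  obtain ⟨B, hB0, hB⟩ := hh.exists_nonneg hr hM V
  obtain ⟨C, hC⟩ := hcb V
  refine ⟨C * B, fun u v hv ↦ ?_⟩
  rw [abs_mul, mul_assoc]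
  have hp : 0 ≤ radialPotential M (r u v) := (radialPotential_pos hM (hr.1 u v)).le
  exact mul_le_mul (hC u v hv) (hB u v hv) (abs_nonneg _) ((abs_nonneg _).trans (hC u v hv))

omit hr hM in
/-- A function bounded on past strips times the potential is potential-dominated. [folklore] -/
lemma isPotentialDominated_potential_mul {f : ℝ → ℝ → ℝ} (hfb : ∀ V, ∃ C, ∀ u v, v ≤ V → |f u v| ≤ C)
    (hV : ∀ u v, 0 ≤ radialPotential M (r u v)) :
    IsPotentialDominated M r (fun u v ↦ radialPotential M (r u v) * f u v) := by
  intro V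
  obtain ⟨C, hC⟩ := hfb V
  refine ⟨C, fun u v hv ↦ ?_⟩
  rw [abs_mul, abs_of_nonneg (hV u v), mul_comm]
  exact mul_le_mul_of_nonneg_right (hC u v hv) (hV u v)

end UPrimitive

end Literature.Barriers.FinalStateConjecture

end
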